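import Mathlib
import HarnessLib
import Literature.AlgebraicGeometry.Motives.SubschemeCyclesCodimProofs
import Literature.AlgebraicGeometry.HodgeTheory.TripleProductCodimension
import Literature.AlgebraicGeometry.Motives.UniversalHyperplaneSectionFamily
import Literature.AlgebraicGeometry.Motives.FamiliesVHS

/-!
# Fibre codimension along a flat family of closed subschemes — item (F4) of the Fulton gap inventory
# (crux `BlochSpreadEightFour`, stmt-HodgeConjecture-18884, line `bloch-lifts-fulton`, stub `stub_fultonSpecialises`)

HONEST FRAMING: helper file; no stub is closed and nothing here proves `BlochSpreadEightFour`, rung H2,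
HC_AV or HC. It DISCHARGES item (F4) of the gap inventory recorded in
`EightfoldBlochSeedsBlochSpreadEightFourFultonSupportStep.lean` for the named fact
`fulton1998_flatFamily_cycleClass_specialises` / its slice `(RC)`
(`EightfoldBlochSeedsBlochSpreadEightFourOfRelativeClass.lean`): the hypothesis `hcodim` of the support
step `map_fiberι_mem_algebraicClasses_of_mem_classesSupportedOn` — "every point of the slice `𝒳_t ∩ T`
has codimension `≥ p` in the fibre `𝒳_t`" — for `T` the support of a closed subscheme `𝒲 ⊆ 𝒳` FLAT
over the base all of whose irreducible components have codimension `≥ p` in `𝒳`.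

## What is proved (sorry-free; no definition, no named fact)

* `add_coheight_le_coheight_apply_of_strictMono` — order theory: a strictly monotone map whose values at
  the maximal elements have coheight `≥ p` raises every finite coheight by at least `p` (a longest chain
  above `x` ends at a maximal element; push it forward and continue with a chain of length `p`).
* `coheight_lt_top_of_isLocallyNoetherian` — points of a locally Noetherian scheme have finite
  codimension (`dim 𝒪_{X,x} < ∞`, Mathlib `ringKrullDim_stalk_eq_coheight`).
* `strictMono_base_of_isEmbedding` — a morphism of schemes which is a topological embedding (e.g. a
  closed immersion) is strictly monotone for the specialisation orders.
* `le_coheight_asFiber_of_flat`, `le_coheight_fiber_of_flat` — **(F4), scheme-theoretic fibres**: for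
  `ι : 𝒲 ↪ 𝒳` a closed immersion with `𝒲 → V` and `𝒳 → V` flat (all locally Noetherian) and every
  maximal point `ξ` of `𝒲` of codimension `≥ p` in `𝒳`, every point `ζ ∈ 𝒲` has codimension `≥ p` in the
  fibre `𝒳_{g ι ζ}` of `g : 𝒳 → V`. PROOF: Hartshorne III Prop. 9.5 for the flat `g` and `ι ≫ g` (the
  tree's `Motives.coheight_eq_coheight_add_coheight_asFiber`, Matsumura Thm. 15.1):
  `codim_𝒳 (ι ζ) = codim_V t + codim_{𝒳_t} (ι ζ)` and `codim_𝒲 ζ ≥ codim_V t`; and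
  `codim_𝒳 (ι ζ) ≥ p + codim_𝒲 ζ` by the order lemma (chains of `𝒲` push forward along `ι` and continue
  above a maximal point of `𝒲` by `p` more steps). No catenarity is used.
* `exists_iso_fiberOver_fiber`, `exists_fiber_coheight_eq` — for a complex point `t` of a SEPARATED
  `ℂ`-scheme `V`, the tree's fibre `Motives.fiberOver g t = 𝒳 ×_V Spec ℂ` is isomorphic over `𝒳` to
  Mathlib's `g.left.fiber t.pt = 𝒳 ×_V Spec κ(t.pt)` (`Spec ℂ ≅ Spec κ(t.pt)` over `V`,
  `Motives.SectionFamily.exists_iso_fromSpecResidueField`), so codimensions in the two fibres agree.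
* `le_coheight_of_mem_range_of_flat_family` — **(F4) in the binder shape of the support step**: for
  `g : 𝒳 ⟶ V` flat over a separated `V`, `ι : 𝒲 ↪ 𝒳` closed with `ι ≫ g` flat, components of `𝒲` of
  codimension `≥ p` in `𝒳`, every `t ∈ V(ℂ)` and every `z ∈ 𝒳_t` lying on `𝒲`:
  `(p : ℕ∞) ≤ Order.coheight z`.

What remains of the Fulton debt after this file: (F1)+(F2) (a relative cycle class on real carriers)
and the non-vanishing half of (F5); see the gap inventory. The hypothesis "every maximal point of `𝒲`
has codimension `≥ p` in `𝒳`" is how the codimension-`p` part of the flat family enters (over the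
connected component of the marked point it follows from the binder `∀ z ∈ W₀ ∪ C, p ≤ codim z` of the
fact, flat components being dominant; that deduction is NOT made here).

References: [Hartshorne1977] III Prop. 9.5, Cor. 9.6; II Ex. 3.20; [Matsumura1987] Thm. 15.1;
[Fulton1998] §10.1 (flat families of cycles), §19.1 eq. (1); [StacksProject] Tag 02IZ
(`dim 𝒪_{X,x}` = codimension), Tag 00OM.
-/

-- every declaration of this problem lives in `Summit.HodgeConjecture.HodgeConjecture.…` (summit = sub-problem)
set_option linter.dupNamespace false

noncomputable section

open CategoryTheory CategoryTheory.Limits AlgebraicGeometry Order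
open Literature.AlgebraicGeometry.Motives Literature.AlgebraicGeometry.HodgeTheory

namespace Summit.HodgeConjecture.HodgeConjecture.Theorems

/-- **Order lemma.** A strictly monotone map `f : α → β` whose values at the MAXIMAL elements of `α`
have coheight `≥ p` raises every finite coheight by at least `p`: `p + coheight x ≤ coheight (f x)`.
A longest chain above `x` ends at a maximal element `m`; its image under `f` is a chain above `f x`
ending at `f m`, which is followed by a chain of length `p`. [folklore] -/
theorem add_coheight_le_coheight_apply_of_strictMono {α β : Type*} [Preorder α] [Preorder β]
    (f : α → β) (hf : StrictMono f) {p : ℕ} (h : ∀ a : α, IsMax a → (p : ℕ∞) ≤ coheight (f a))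
    (x : α) (hx : coheight x < ⊤) : (p : ℕ∞) + coheight x ≤ coheight (f x) := by
  obtain ⟨n, hn⟩ := ENat.ne_top_iff_exists.mp hx.ne
  rw [← hn]
  obtain ⟨s, hhead, hlen⟩ := exists_series_of_coheight_eq_coe x hn.symm
  -- the last element of a longest series above `x` is maximal
  have hmax : IsMax s.last := by
    intro y hy
    by_contra hyx
    have hlt : s.last < y := lt_of_le_not_ge hy hyx
    have h1 := length_le_coheight_head (p := s.snoc y hlt)
    rw [RelSeries.head_snoc, RelSeries.snoc_length, hhead, ← hn, hlen] at h1
    exact absurd (by exact_mod_cast h1 : n + 1 ≤ n) (by omega)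
  -- a series of length `p` above `f s.last`
  obtain ⟨r, hrhead, hrlen⟩ := exists_series_of_le_coheight (f s.last) (h _ hmax)
  -- concatenate `f ∘ s` and `r`
  have hconn : (s.map f hf).last = r.head := by rw [LTSeries.last_map, hrhead]
  have h2 := length_le_coheight_head (p := RelSeries.smash (s.map f hf) r hconn)
  rw [RelSeries.head_smash, LTSeries.head_map, hhead, RelSeries.smash_length, LTSeries.map_length,
    hlen, hrlen] at h2
  calc (p : ℕ∞) + (n : ℕ∞) = ((n + p : ℕ) : ℕ∞) := by push_cast; ring
    _ ≤ coheight (f x) := h2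

/-- Points of a locally Noetherian scheme have finite codimension: `coheight x = dim 𝒪_{X,x} < ∞`
(Mathlib `ringKrullDim_stalk_eq_coheight`; a Noetherian local ring has finite dimension).
[cite: StacksProject, Tag 02IZ] -/
theorem coheight_lt_top_of_isLocallyNoetherian {X : Scheme} [IsLocallyNoetherian X] (x : X) :
    coheight x < ⊤ := by
  have h1 := ringKrullDim_lt_top (R := X.presheaf.stalk x)
  rw [ringKrullDim_stalk_eq_coheight] at h1
  by_contra htop
  rw [not_lt, top_le_iff] at htop
  rw [htop] at h1
  exact lt_irrefl _ (lt_of_lt_of_le h1 le_top)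

/-- A morphism of schemes which is a topological embedding (e.g. a closed immersion) is strictly
monotone for the specialisation orders (`a ≤ b ↔ b ⤳ a`; an embedding preserves and reflects
specialisation). [folklore] -/
theorem strictMono_base_of_isEmbedding {W X : Scheme} (ι : W ⟶ X)
    (hι : Topology.IsEmbedding ι.base) : StrictMono (fun w : W => ι.base w) := by
  intro a b hab
  rw [lt_iff_le_not_ge, Scheme.le_iff_specializes, Scheme.le_iff_specializes] at hab ⊢
  exact ⟨hab.1.map ι.continuous, fun h' => hab.2 (hι.specializes_iff.mp h')⟩

/-- **Fibre codimension along a flat family (Hartshorne III Prop. 9.5, twice).** Let `ι : W ⟶ X` be a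
closed immersion and `g : X ⟶ V` with `g` and `ι ≫ g` flat, all schemes locally Noetherian, and suppose
every maximal point `ξ` of `W` (generic point of an irreducible component) has codimension `≥ p` in `X`.
Then every `ζ ∈ W` has codimension `≥ p` in the scheme-theoretic fibre of `g` through `ι ζ`:
`codim_𝒳 (ι ζ) = codim_V (g ι ζ) + codim_{fibre} (ι ζ)` (flat `g`), `codim_W ζ ≥ codim_V (g ι ζ)`
(flat `ι ≫ g`), and `codim_𝒳 (ι ζ) ≥ p + codim_W ζ` (`add_coheight_le_coheight_apply_of_strictMono`).
[cite: Hartshorne1977, III Prop. 9.5] [cite: Matsumura1987, Thm. 15.1] -/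
theorem le_coheight_asFiber_of_flat {W X V : Scheme} (ι : W ⟶ X) (g : X ⟶ V) [IsClosedImmersion ι]
    [Flat g] [Flat (ι ≫ g)] [IsLocallyNoetherian W] [IsLocallyNoetherian X] [IsLocallyNoetherian V]
    {p : ℕ} (h : ∀ ξ : W, IsMax ξ → (p : ℕ∞) ≤ coheight (ι.base ξ)) (ζ : W) :
    (p : ℕ∞) ≤ coheight (g.asFiber (ι.base ζ)) := by
  have hA := Literature.AlgebraicGeometry.Motives.coheight_eq_coheight_add_coheight_asFiber g (ι.base ζ)
  have hB := Literature.AlgebraicGeometry.Motives.coheight_eq_coheight_add_coheight_asFiber (ι ≫ g) ζ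
  have hC := add_coheight_le_coheight_apply_of_strictMono _
    (strictMono_base_of_isEmbedding ι ι.isEmbedding) h ζ (coheight_lt_top_of_isLocallyNoetherian ζ)
  have htfin : coheight (g.base (ι.base ζ)) ≠ ⊤ :=
    (coheight_lt_top_of_isLocallyNoetherian _).ne
  have hcomp : (ι ≫ g).base ζ = g.base (ι.base ζ) := rfl
  have hB' : coheight (g.base (ι.base ζ)) ≤ coheight ζ := by
    rw [← hcomp, hB]; exact le_self_add
  have h1 : (p : ℕ∞) + coheight (g.base (ι.base ζ)) ≤
      coheight (g.base (ι.base ζ)) + coheight (g.asFiber (ι.base ζ)) :=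
    calc (p : ℕ∞) + coheight (g.base (ι.base ζ)) ≤ (p : ℕ∞) + coheight ζ :=
          by gcongr
      _ ≤ coheight (ι.base ζ) := hC
      _ = _ := hA
  rw [add_comm (p : ℕ∞)] at h1
  exact (WithTop.add_le_add_iff_left htfin).mp h1

/-- **Fibre codimension along a flat family, fibre-point form**: as `le_coheight_asFiber_of_flat`, for
any point `y` of the scheme-theoretic fibre `g.fiber s` lying over `ι ζ` (then `s = g (ι ζ)` and
`y = g.asFiber (ι ζ)`). [cite: Hartshorne1977, III Prop. 9.5] -/
theorem le_coheight_fiber_of_flat {W X V : Scheme} (ι : W ⟶ X) (g : X ⟶ V) [IsClosedImmersion ι]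
    [Flat g] [Flat (ι ≫ g)] [IsLocallyNoetherian W] [IsLocallyNoetherian X] [IsLocallyNoetherian V]
    {p : ℕ} (h : ∀ ξ : W, IsMax ξ → (p : ℕ∞) ≤ coheight (ι.base ξ)) (ζ : W) {s : V}
    (y : ↥(g.fiber s)) (hy : (g.fiberι s).base y = ι.base ζ) : (p : ℕ∞) ≤ coheight y := by
  have hs : g.base (ι.base ζ) = s := by
    have hmem : ι.base ζ ∈ Set.range (g.fiberι s).base := ⟨y, hy⟩
    rw [Scheme.Hom.range_fiberι] at hmem
    simpa using hmem
  subst hs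
  have hy' : y = g.asFiber (ι.base ζ) :=
    (g.fiberι (g.base (ι.base ζ))).isEmbedding.injective (by rw [hy, Scheme.Hom.fiberι_asFiber])
  subst hy'
  exact le_coheight_asFiber_of_flat ι g h ζ

/-- **The two fibres over a complex point agree.** For a morphism of `ℂ`-schemes `g : 𝒳 ⟶ V` with `V`
separated over `ℂ` and `t ∈ V(ℂ)`, the tree's fibre `Motives.fiberOver g t = 𝒳 ×_V Spec ℂ` is
isomorphic, compatibly with the two inclusions into `𝒳`, to Mathlib's scheme-theoretic fibre
`g.left.fiber t.pt = 𝒳 ×_V Spec κ(t.pt)`: the closed points `Spec ℂ ⟶ V` and `Spec κ(t.pt) ⟶ V` are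
isomorphic over `V` (`Motives.SectionFamily.exists_iso_fromSpecResidueField`), and pull-backs along
isomorphic legs are isomorphic (`IsPullback.of_right'`). [cite: Hartshorne1977, II.3 (fibre of a morphism, p. 89)] -/
theorem exists_iso_fiberOver_fiber {𝒳 V : SchemeOver ℂ} (g : 𝒳 ⟶ V) [IsSeparated V.hom]
    (t : ComplexPoints V) :
    ∃ e : (fiberOver g t).left ≅ g.left.fiber t.pt,
      e.hom ≫ g.left.fiberι t.pt = (fiberι g t).left := by
  obtain ⟨φ, hφ⟩ := SectionFamily.exists_iso_fromSpecResidueField t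
  have H1 : IsPullback (pullback.fst g.left t.left) (pullback.snd g.left t.left) g.left
      (φ.hom ≫ V.left.fromSpecResidueField t.pt) := by
    rw [hφ]; exact IsPullback.of_hasPullback _ _
  have H2 : IsPullback (g.left.fiberι t.pt) (g.left.fiberToSpecResidueField t.pt) g.left
      (V.left.fromSpecResidueField t.pt) := IsPullback.of_hasPullback _ _
  have main : ∃ e : pullback g.left t.left ≅ g.left.fiber t.pt,
      e.hom ≫ g.left.fiberι t.pt = pullback.fst g.left t.left := by
    have Q := IsPullback.of_right' H1 H2
    haveI := Q.isIso_fst_of_isIso (inferInstance : IsIso φ.hom)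
    exact ⟨asIso (H2.lift (pullback.fst g.left t.left) (pullback.snd g.left t.left ≫ φ.hom)
        (H1.w.trans (Category.assoc _ _ _).symm)), H2.lift_fst _ _ _⟩
  exact main

/-- Codimension in the tree's fibre `fiberOver g t` equals codimension in Mathlib's fibre `g.left.fiber
t.pt` at corresponding points (an isomorphism of schemes preserves coheights,
`coheight_eq_of_isOpenImmersion`). [cite: Hartshorne1977, II.3 (fibre of a morphism, p. 89)] -/
theorem exists_fiber_coheight_eq {𝒳 V : SchemeOver ℂ} (g : 𝒳 ⟶ V) [IsSeparated V.hom]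
    (t : ComplexPoints V) (z : (fiberOver g t).left) :
    ∃ y : ↥(g.left.fiber t.pt), (g.left.fiberι t.pt).base y = (fiberι g t).left.base z ∧
      coheight y = coheight z := by
  obtain ⟨e, he⟩ := exists_iso_fiberOver_fiber g t
  refine ⟨e.hom.base z, ?_, coheight_eq_of_isOpenImmersion e.hom⟩
  rw [← Scheme.Hom.comp_apply, he]

/-- **(F4) in the binder shape of the support step.** For `g : 𝒳 ⟶ V` flat over a separated `V`,
`ι : 𝒲 ↪ 𝒳` a closed immersion with `ι ≫ g` flat (all locally Noetherian), and every maximal point of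
`𝒲` of codimension `≥ p` in `𝒳`: every point `z` of the fibre `𝒳_t = Motives.fiberOver g t`,
`t ∈ V(ℂ)`, lying on `𝒲` has `(p : ℕ∞) ≤ Order.coheight z` — exactly the hypothesis `hcodim` of
`map_fiberι_mem_algebraicClasses_of_mem_classesSupportedOn` for `T = ι(𝒲)`.
[cite: Hartshorne1977, III Prop. 9.5 and Cor. 9.6] [cite: Fulton1998, §10.1] -/
theorem le_coheight_of_mem_range_of_flat_family {𝒳 V : SchemeOver ℂ} (g : 𝒳 ⟶ V)
    [IsSeparated V.hom] [Flat g.left] [IsLocallyNoetherian 𝒳.left] [IsLocallyNoetherian V.left]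
    {𝒲 : Scheme} (ι : 𝒲 ⟶ 𝒳.left) [IsClosedImmersion ι] [Flat (ι ≫ g.left)]
    [IsLocallyNoetherian 𝒲] {p : ℕ} (h : ∀ ξ : 𝒲, IsMax ξ → (p : ℕ∞) ≤ coheight (ι.base ξ))
    (t : ComplexPoints V) (z : (fiberOver g t).left) (hz : (fiberι g t).left.base z ∈ Set.range ι.base) :
    (p : ℕ∞) ≤ coheight z := by
  obtain ⟨ζ, hζ⟩ := hz
  obtain ⟨y, hy, hyz⟩ := exists_fiber_coheight_eq g t z
  rw [← hyz]
  exact le_coheight_fiber_of_flat ι g.left h ζ y (by rw [hy, hζ])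

end Summit.HodgeConjecture.HodgeConjecture.Theorems

end
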